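import Literature.AlgebraicGeometry.ComplexMultiplication.CyclotomicFermatCMTypesTheoremOneEveryLevel
import Literature.AlgebraicGeometry.ComplexMultiplication.CyclotomicFermatCMTypesTheoremTwoBoundaryInstances
import HarnessLib

/-!
# Koblitz–Rohrlich THEOREM 2 IN FULL AT EVERY LEVEL `N` PRIME TO `6` — relatively prime AND boundary triples: the stabiliser
# `W_{1,a,−1−a}` for EVERY `a` (the two printed families are the only exceptions), simplicity of the abelian varieties of type
# `Φ_{(1,a,−1−a)}`; and "`L_{r,s,t}` is simple" when the entries have a common factor with the level

Layer `Literature/AlgebraicGeometry/ComplexMultiplication`, namespace `…ComplexMultiplication.CyclotomicFermatCMType`; sequel of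
`CyclotomicFermatCMTypesTheoremTwoBoundaryInstances` (Theorem 2 in full at `N = 25, 35` by kernel tables; the bridges `wH = H ⟺ H_{wτ} =
H_τ`, "a stabilising unit gives a coincidence") and `CyclotomicFermatCMTypesTheoremOneEveryLevel` (Theorem 1 (i) for all admissible triples
at every level prime to `6`, this lane gen 40), whose junction turns the kernel tables into a theorem at every level.  THEOREMS ONLY (no
definition, no named fact, no `sorry`, no kernel enumeration).

THE SOURCE.  N. Koblitz, D. Rohrlich, *Simple factors in the Jacobian of a Fermat curve*, Canad. J. Math. **30** (1978) 1183–1205 (held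
`paper:koblitz1978-simple-factors-jacobian-fermat-curve`, pp. 1184–1186 read first-hand).  P. 1184: "`L_{r,s}` is simple if and only if
`W_{r,s} = {1}`".  P. 1185: "The same combinatorial result will allow us to determine when a lattice `L_{r,s,t}` is simple. For if `w` is in
`W_{r,s,t}`, then `H_{r,s,t} = wH_{r,s,t} = H_{⟨w⁻¹r⟩,⟨w⁻¹s⟩,⟨w⁻¹t⟩}` so that `{r, s, t} = {⟨w⁻¹r⟩, ⟨w⁻¹s⟩, ⟨w⁻¹t⟩}`. If at least one of
`rM/N, sM/N, tM/N` is prime to `M` (where `N/M = g.c.d.(r, s, t, N)`) then one deduces that for `w ≠ 1`, either `1 + w + w² = 0` in `ℤ/Mℤ`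
or `w² = 1` in `ℤ/Mℤ`. It follows that after multiplying by an element of `(ℤ/Nℤ)*`, we have `{r, s, t} = {N/M, ⟨wN/M⟩, ⟨w²N/M⟩}` or
`{r, s, t} = {N/M, ⟨wN/M⟩, ⟨−(1+w)N/M⟩}` respectively. On the other hand, suppose `rM/N, sM/N, tM/N` each have a common factor with `M`.
Then necessarily `⟨w⁻¹r⟩ = r`, `⟨w⁻¹s⟩ = s`, `⟨w⁻¹t⟩ = t`, whence `w ≡ 1 mod M`. Hence `L_{r,s,t}` is simple. To summarize: THEOREM 2.
Suppose `N` is prime to `6`. The only lattices `L_{r,s,t}` which are not simple are those for which `{r, s, t}` is equivalent to a triple of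
the form `{N/M, ⟨wN/M⟩, ⟨w²N/M⟩}`, for some divisor `M` of `N`, and some `w ∈ ℤ/Mℤ` such that `1 + w + w² = 0`, or to a triple of the form
`{N/M, ⟨wN/M⟩, ⟨−(1 + w)N/M⟩}`, for some divisor `M` of `N`, and some `w ∈ ℤ/Mℤ` such that `w² = 1`, `w ≠ ±1`."

READING (as in the siblings).  Level `M = N` (primitive triples); `W_τ = {1}` is the tree's `HasTrivialStabilizer N H_τ`; a triple with a
unit entry is normalised to `(1, a, −1−a)` with `a, −1−a ≠ 0` and NO unit hypothesis on `a`, `1 + a` (the second family `{1, w, −1−w}`,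
`w² = 1`, `w ≠ ±1`, has the non-unit entry `−1−w`); "simple" is read on abelian varieties realising the CM type `Φ_{H_τ}` (Shimura–Taniyama,
tree `isSimple_iff_isPrimitive`, `isPrimitive_iff_hasTrivialStabilizer`).  The "combinatorial result" `{r, s, t} = {⟨w⁻¹r⟩, ⟨w⁻¹s⟩, ⟨w⁻¹t⟩}`
is Theorem 1 (i) for ALL admissible triples (`multiset_eq_of_fermatCMType_eq_coprimeSix`, gen 40) — the reason the general-level boundary
form of Theorem 2 had to wait for the §3 Proposition.

## What is proved (every `N` prime to `6`)

* §1 **`eq_one_or_families_of_multiset_eq`** (`N` prime to `3`, `a, −1−a ≠ 0`, `v` with `{v, va, v(−1−a)} = {1, a, −1−a}` ⟹ `v = 1`, or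
  `1 + a + a² = 0`, `a ≠ 1`, `v ∈ {a, a²}`, or `a² = 1`, `a ≠ ±1`, `v = a`, or `(1+a)² = 1`, `a ∉ {0, −2}`, `v = −1−a`) and its converse
  `multiset_eq_of_families`.
* §2 **`fermatCMType_mul_eq_iff_coprimeSix`** = THE STABILISER TABLE at every level prime to `6` (`H_{w,wa,w(−1−a)} = H_{1,a,−1−a}` iff `w =
  1` or one of the family conditions); **`hasTrivialStabilizer_fermat_one_iff_coprimeSix`** = THEOREM 2's dichotomy `W_{1,a,−1−a} = {1} ⟺`
  NOT (`1 + a + a² = 0 ∧ a ≠ 1`) ∧ NOT (`a² = 1 ∧ a ≠ ±1`) ∧ NOT (`(1+a)² = 1 ∧ a ∉ {0, −2}`); **`isPrimitive_fermat_one_iff_coprimeSix`**,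
  **`isSimple_of_fermat_one_iff_coprimeSix`** = THEOREM 2 IN FULL on CM types ∕ abelian varieties for every triple through `1`, unit OR
  boundary (superseding the siblings' unit-triple forms `…_of_five_le_primeFactors` and the tables at `25`, `35`).
* §3 **`eq_one_of_forall_mem_iff_of_not_isUnit`** ("suppose `rM/N, sM/N, tM/N` each have a common factor with `M` … whence `w ≡ 1`": for a
  primitive admissible `τ` with `r`, `s` non-units — two suffice —, a stabilising unit is `1`), **`hasTrivialStabilizer_of_not_isUnit`**,
  **`isSimple_of_not_isUnit`** ("Hence `L_{r,s,t}` is simple").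

## Honest column / NOT here

* K–R's "necessarily `⟨w⁻¹r⟩ = r, …`" is proved here through primitivity (a prime of `⟨r⟩` cannot divide a second entry) and "`w ≡ 1 mod
  M`" through `N ∣ ⟨w − 1⟩·g.c.d.(⟨r⟩, ⟨s⟩)` with `g.c.d.(⟨r⟩, ⟨s⟩)` prime to `N`; only two non-unit entries are used.
* Level `M = N` only: the factors of lower level `M < N` are the same statements at level `M` (the tree's change of level
  `CyclotomicFermatCMTypesLevelPullback` ∕ `…LevelOnVarieties`); the count `|W|` as an isogeny decomposition "into `|W|` isomorphic simple
  factors" is not typed (as in the siblings); the last sentence of Theorem 2 ("if `N` equals a prime `p` … simple if `p ≡ 2 mod 3`") is the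
  siblings' (`…PrimeLevelSimple`, `…PrimePowerLevelSimple`).
* "Simple" is a statement about abelian varieties REALISING `Φ_{H_τ}` when `H_τ` IS a CM type (hypothesis `hS`), as everywhere in this
  series; Jacobians are not constructed.

## References

* [KoblitzRohrlich1978] N. Koblitz, D. Rohrlich, Canad. J. Math. 30 (1978) 1183–1205: Theorem 2 and its proof (pp. 1185–1186), §1
  (p. 1184).
* [Shimura1998] G. Shimura, *Abelian Varieties with Complex Multiplication and Modular Functions* (1998), §8.2 Prop. 26, §8.4 Example (1)
  (through `SimpleIffPrimitiveCMType`, `CyclotomicCMTypeResidueSets`).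

## Provenance

Cell `pub-hodgecm2` (COR-CM), literature seat `lit-deligne-3` gen 40 (claim KR78-THM2-EVERY-LEVEL; count-neutral, own lane).  HC_CM is NOT
proved and nothing here bears on it.
-/

noncomputable section

open NumberField

namespace Literature.AlgebraicGeometry.ComplexMultiplication

open Literature.NumberTheory.ComplexMultiplication
open Literature.AlgebraicGeometry.HodgeTheory
open Literature.AlgebraicGeometry.Pohlmann1968 Literature.AlgebraicGeometry.Pohlmann1968.Cyclotomic
open CyclotomicCMTypeResidueSets (IsCMResidueSet HasTrivialStabilizer unitResidues)

namespace CyclotomicFermatCMType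

/-! ## §0 Bridges (private copies) and two-element multisets -/

section Bridge

variable {N : ℕ} [NeZero N]

/-- Units of `ℤ/N` are the residues with value prime to `N` (private copy). [folklore] -/
private theorem isUnit_iff_val_coprime_tw (x : ZMod N) : IsUnit x ↔ x.val.Coprime N := by
  conv_lhs => rw [← ZMod.natCast_zmod_val x]
  exact ZMod.isUnit_iff_coprime x.val N

/-- The generic bridge (private copy of the sibling's): a table "`H_{w,wa,w(−1−a)} = H_{1,a,−1−a}` iff `w = 1 ∨ E w`" with `E w → w ≠ 1`
gives `W_{1,a,−1−a} = {1}` iff no unit `w` satisfies `E w`. [cite: KoblitzRohrlich1978, §1 (p. 1184) and proof of Theorem 2 (p. 1185)] -/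
private theorem hasTrivialStabilizer_iff_of_table_tw {a : ZMod N} {E : ZMod N → Prop}
    (table : ∀ w : ZMod N, IsUnit w → (fermatCMType N w (w * a) (w * (-1 - a)) = fermatCMType N 1 a (-1 - a) ↔ (w = 1 ∨ E w)))
    (hE : ∀ w, E w → w ≠ 1) :
    HasTrivialStabilizer N (fermatCMType N 1 a (-1 - a)) ↔ ¬∃ w : ZMod N, IsUnit w ∧ E w := by
  constructor
  · rintro hW ⟨w, hw, hEw⟩
    have heq : fermatCMType N w (w * a) (w * (-1 - a)) = fermatCMType N 1 a (-1 - a) := (table w hw).2 (Or.inr hEw)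
    have h1 : fermatCMType N (w * 1) (w * a) (w * (-1 - a)) = fermatCMType N 1 a (-1 - a) := by rw [mul_one]; exact heq
    have hall := (forall_mem_iff_mul_mem_iff_fermatCMType_mul_eq hw).2 h1
    refine hE w hEw (hW w ((mem_unitResidues_iff_isUnit w).2 hw) fun c _ => ?_)
    rw [mul_comm]
    exact (hall c).symm
  · intro H t ht hstab
    have htu : IsUnit t := (mem_unitResidues_iff_isUnit t).1 ht
    rcases (table t htu).1 (fermatCMType_mul_eq_of_forall_mem_unitResidues htu hstab) with h1 | hEt
    · exact h1
    · exact absurd ⟨t, htu, hEt⟩ H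

omit [NeZero N] in
/-- Equality of two-element multisets. [folklore] -/
private theorem pair_eq_pair_tw {x y z w : ZMod N} (h : ({x, y} : Multiset (ZMod N)) = {z, w}) :
    (x = z ∧ y = w) ∨ (x = w ∧ y = z) := by
  have hx : x ∈ ({z, w} : Multiset (ZMod N)) := by rw [← h]; simp
  simp only [Multiset.insert_eq_cons, Multiset.mem_cons, Multiset.mem_singleton] at hx
  rcases hx with rfl | rfl
  · left
    refine ⟨rfl, ?_⟩
    have h' : (x ::ₘ {y} : Multiset (ZMod N)) = x ::ₘ {w} := by simpa [Multiset.insert_eq_cons] using h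
    exact Multiset.singleton_inj.1 ((Multiset.cons_inj_right x).1 h')
  · right
    refine ⟨rfl, ?_⟩
    have h' : (x ::ₘ {y} : Multiset (ZMod N)) = x ::ₘ {z} := by
      have h'' := h
      rw [Multiset.pair_comm z x] at h''
      simpa [Multiset.insert_eq_cons] using h''
    exact Multiset.singleton_inj.1 ((Multiset.cons_inj_right x).1 h')

omit [NeZero N] in
/-- `3 ≠ 0` modulo an `N > 1` prime to `3`. [folklore] -/
private theorem three_ne_zero_tw [NeZero N] (hN3 : Nat.Coprime 3 N) {a : ZMod N} (ha : a ≠ 0) : (3 : ZMod N) ≠ 0 := by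
  intro h3
  have h : ((3 : ℕ) : ZMod N) = 0 := by exact_mod_cast h3
  rw [ZMod.natCast_eq_zero_iff] at h
  have hN1 : N = 1 := Nat.Coprime.eq_one_of_dvd hN3.symm h
  subst hN1
  exact ha (Subsingleton.elim _ _)

end Bridge

/-! ## §1 The combinatorics of `{v, va, v(−1−a)} = {1, a, −1−a}` for ANY `a` ("for `w ≠ 1`, either `1 + w + w² = 0` or `w² = 1`") -/

section Combinatorics

variable {N : ℕ} [NeZero N]

/-- **K–R's two families, from a unit permuting `(1, a, −1−a)`** ("If at least one of `rM/N, sM/N, tM/N` is prime to `M` … one deduces that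
for `w ≠ 1`, either `1 + w + w² = 0` in `ℤ/Mℤ` or `w² = 1` in `ℤ/Mℤ` … `{r,s,t} = {N/M, ⟨wN/M⟩, ⟨w²N/M⟩}` or `{N/M, ⟨wN/M⟩, ⟨−(1+w)N/M⟩}`",
p. 1185), for ANY `a` with `a, −1−a ≠ 0` (unit OR boundary) at `N` prime to `3`: if a unit `v` has `{v, va, v(−1−a)} = {1, a, −1−a}`, then
`v = 1`, or `1 + a + a² = 0`, `a ≠ 1`, `v ∈ {a, a²}` (first family, `{1, a, −1−a} = {1, w, w²}`), or `a² = 1`, `a ≠ ±1`, `v = a`, or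
`(1 + a)² = 1`, `a ∉ {0, −2}`, `v = −1−a` (second family `{1, w, −1−w}`, `w² = 1`, `w ≠ ±1`, with `w = a`, resp. `w = −1−a`).
[cite: KoblitzRohrlich1978, proof of Theorem 2 (p. 1185)] -/
theorem eq_one_or_families_of_multiset_eq (hN3 : Nat.Coprime 3 N) {a v : ZMod N} (ha : a ≠ 0) (ha' : (-1 - a : ZMod N) ≠ 0)
    (h : ({v, v * a, v * (-1 - a)} : Multiset (ZMod N)) = {1, a, -1 - a}) :
    v = 1 ∨ ((1 + a + a ^ 2 = 0 ∧ a ≠ 1 ∧ (v = a ∨ v = a ^ 2)) ∨ (a ^ 2 = 1 ∧ a ≠ 1 ∧ a ≠ -1 ∧ v = a) ∨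
      ((1 + a) ^ 2 = 1 ∧ a ≠ 0 ∧ a ≠ -2 ∧ v = -1 - a)) := by
  classical
  have h3 := three_ne_zero_tw hN3 ha
  have pc : ∀ x y : ZMod N, (x ::ₘ {y} : Multiset (ZMod N)) = y ::ₘ {x} := fun x y => by
    simpa [Multiset.insert_eq_cons] using Multiset.pair_comm x y
  have hv : v ∈ ({1, a, -1 - a} : Multiset (ZMod N)) := by rw [← h]; simp
  simp only [Multiset.insert_eq_cons, Multiset.mem_cons, Multiset.mem_singleton] at hv
  rcases hv with hv1 | hva | hvb
  · exact Or.inl hv1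
  · -- `v = a`
    subst v
    by_cases ha1 : a = 1
    · exact Or.inl ha1
    have h' : (a ::ₘ {a * a, a * (-1 - a)} : Multiset (ZMod N)) = a ::ₘ {1, -1 - a} := by
      have e : ({1, a, -1 - a} : Multiset (ZMod N)) = a ::ₘ {1, -1 - a} := by
        simp only [Multiset.insert_eq_cons]; exact Multiset.cons_swap 1 a _
      rw [← e]; simpa [Multiset.insert_eq_cons] using h
    rcases pair_eq_pair_tw ((Multiset.cons_inj_right a).1 h') with ⟨h1, h2⟩ | ⟨h1, h2⟩
    · -- `a² = 1`: the second family with `w = a`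
      have hane : a ≠ -1 := fun e => ha' (by rw [e]; ring)
      exact Or.inr (Or.inr (Or.inl ⟨by rw [sq]; exact h1, ha1, hane, rfl⟩))
    · -- `a² = −1−a`: the first family with `w = a`
      exact Or.inr (Or.inl ⟨by linear_combination h1, ha1, Or.inl rfl⟩)
  · -- `v = −1−a`
    subst v
    by_cases hb1 : (-1 - a : ZMod N) = 1
    · exact Or.inl hb1
    have h' : ((-1 - a) ::ₘ {(-1 - a) * a, (-1 - a) * (-1 - a)} : Multiset (ZMod N)) = (-1 - a) ::ₘ {1, a} := by
      have e : ({1, a, -1 - a} : Multiset (ZMod N)) = (-1 - a) ::ₘ {1, a} := by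
        simp only [Multiset.insert_eq_cons]
        calc (1 ::ₘ a ::ₘ {(-1 - a)} : Multiset (ZMod N)) = 1 ::ₘ (-1 - a) ::ₘ {a} := by rw [pc a (-1 - a)]
          _ = (-1 - a) ::ₘ 1 ::ₘ {a} := Multiset.cons_swap 1 (-1 - a) _
      rw [← e]; simpa [Multiset.insert_eq_cons] using h
    rcases pair_eq_pair_tw ((Multiset.cons_inj_right (-1 - a)).1 h') with ⟨h1, h2⟩ | ⟨h1, h2⟩
    · -- `(−1−a)a = 1`, `(−1−a)² = a`: the first family with `w = −1−a = a²`
      have hfam : 1 + a + a ^ 2 = 0 := by linear_combination h2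
      have ha1 : a ≠ 1 := fun e => h3 (by rw [e] at hfam; linear_combination hfam)
      exact Or.inr (Or.inl ⟨hfam, ha1, Or.inr (by linear_combination (-1 : ZMod N) * hfam)⟩)
    · -- `(−1−a)² = 1`: the second family with `w = −1−a`
      have ha2 : a ≠ -2 := fun e => hb1 (by rw [e]; ring)
      exact Or.inr (Or.inr (Or.inr ⟨by linear_combination h2, ha, ha2, rfl⟩))

omit [NeZero N] in
/-- The converse: on the two families the unit `w` permutes `(1, a, −1−a)` (`w·(1, w, w²) = (w, w², 1)` as `w³ = 1`; `w·(1, w, −1−w) =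
(w, 1, −1−w)` as `w² = 1`). [cite: KoblitzRohrlich1978, proof of Theorem 2 (p. 1185)] -/
theorem multiset_eq_of_families [NeZero N] {a v : ZMod N}
    (h : (1 + a + a ^ 2 = 0 ∧ a ≠ 1 ∧ (v = a ∨ v = a ^ 2)) ∨ (a ^ 2 = 1 ∧ a ≠ 1 ∧ a ≠ -1 ∧ v = a) ∨
      ((1 + a) ^ 2 = 1 ∧ a ≠ 0 ∧ a ≠ -2 ∧ v = -1 - a)) :
    ({v, v * a, v * (-1 - a)} : Multiset (ZMod N)) = {1, a, -1 - a} := by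
  have pc : ∀ x y : ZMod N, (x ::ₘ {y} : Multiset (ZMod N)) = y ::ₘ {x} := fun x y => by
    simpa [Multiset.insert_eq_cons] using Multiset.pair_comm x y
  rcases h with ⟨hf, -, hv | hv⟩ | ⟨hf, -, -, hv⟩ | ⟨hf, -, -, hv⟩ <;> subst v
  · -- `w = a`, first family: `(a, a², a(−1−a)) = (a, −1−a, 1)`
    have e1 : a * a = -1 - a := by linear_combination hf
    have e2 : a * (-1 - a) = 1 := by linear_combination (-1 : ZMod N) * hf
    rw [e1, e2]
    simp only [Multiset.insert_eq_cons]
    calc (a ::ₘ (-1 - a) ::ₘ {(1 : ZMod N)} : Multiset (ZMod N)) = a ::ₘ 1 ::ₘ {(-1 - a)} := by rw [pc (-1 - a) 1]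
      _ = 1 ::ₘ a ::ₘ {(-1 - a)} := Multiset.cons_swap a 1 _
  · -- `w = a²`, first family: `(a², a³, a²(−1−a)) = (−1−a, 1, a)`
    have e0 : a ^ 2 = -1 - a := by linear_combination hf
    have e1 : a ^ 2 * a = 1 := by linear_combination (a - 1) * hf
    have e2 : a ^ 2 * (-1 - a) = a := by linear_combination (-a) * hf
    rw [e1, e2, e0]
    simp only [Multiset.insert_eq_cons]
    calc ((-1 - a) ::ₘ 1 ::ₘ {a} : Multiset (ZMod N)) = 1 ::ₘ (-1 - a) ::ₘ {a} := Multiset.cons_swap (-1 - a) 1 _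
      _ = 1 ::ₘ a ::ₘ {(-1 - a)} := by rw [pc (-1 - a) a]
  · -- `w = a`, second family: `(a, a², a(−1−a)) = (a, 1, −1−a)`
    have e1 : a * a = 1 := by rw [← sq]; exact hf
    have e2 : a * (-1 - a) = -1 - a := by linear_combination (-1 : ZMod N) * hf
    rw [e1, e2]
    simp only [Multiset.insert_eq_cons]
    exact Multiset.cons_swap a 1 _
  · -- `w = −1−a`, second family: `((−1−a), (−1−a)a, (−1−a)²) = (−1−a, a, 1)`
    have e1 : (-1 - a) * a = a := by linear_combination (-1 : ZMod N) * hf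
    have e2 : (-1 - a) * (-1 - a) = 1 := by linear_combination hf
    rw [e1, e2]
    simp only [Multiset.insert_eq_cons]
    calc ((-1 - a) ::ₘ a ::ₘ {(1 : ZMod N)} : Multiset (ZMod N)) = (-1 - a) ::ₘ 1 ::ₘ {a} := by rw [pc a 1]
      _ = 1 ::ₘ (-1 - a) ::ₘ {a} := Multiset.cons_swap (-1 - a) 1 _
      _ = 1 ::ₘ a ::ₘ {(-1 - a)} := by rw [pc (-1 - a) a]

end Combinatorics

/-! ## §2 THEOREM 2 IN FULL at every level prime to `6`: the stabiliser table for every `a`, `W_{1,a,−1−a}`, primitivity, simplicity -/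

section TheoremTwo

variable {N : ℕ} [NeZero N]

/-- **THE STABILISER TABLE AT EVERY LEVEL `N` PRIME TO `6`** (the sibling's kernel tables at `25`, `35` made a theorem): for `a, −1−a ≠ 0`
(unit OR boundary) and a unit `w`, `H_{w,wa,w(−1−a)} = H_{1,a,−1−a}` iff `w = 1`, or `{1, a, −1−a}` is the first family `{1, w, w²}`
(`1 + a + a² = 0`, `a ≠ 1`, `w ∈ {a, a²}`), or the second family `{1, w, −1−w}` (`w² = 1`, `w ≠ ±1`; `w = a` or `w = −1−a`).  `⟹` is
THEOREM 1 (i) for all admissible triples (`multiset_eq_of_fermatCMType_eq_coprimeSix`) and §1; `⟸` is "`w` permutes the triple".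
[cite: KoblitzRohrlich1978, Theorem 2 and its proof (pp. 1185–1186)] -/
theorem fermatCMType_mul_eq_iff_coprimeSix (hN2 : Nat.Coprime 2 N) (hN3 : Nat.Coprime 3 N) {a w : ZMod N} (ha : a ≠ 0)
    (ha' : (-1 - a : ZMod N) ≠ 0) (hw : IsUnit w) :
    fermatCMType N w (w * a) (w * (-1 - a)) = fermatCMType N 1 a (-1 - a) ↔
      (w = 1 ∨ ((1 + a + a ^ 2 = 0 ∧ a ≠ 1 ∧ (w = a ∨ w = a ^ 2)) ∨ (a ^ 2 = 1 ∧ a ≠ 1 ∧ a ≠ -1 ∧ w = a) ∨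
        ((1 + a) ^ 2 = 1 ∧ a ≠ 0 ∧ a ≠ -2 ∧ w = -1 - a))) := by
  haveI : Nontrivial (ZMod N) := ⟨⟨a, 0, ha⟩⟩
  constructor
  · intro hEq
    have hw0 : w ≠ 0 := hw.ne_zero
    have hwa : w * a ≠ 0 := fun h => ha (hw.mul_right_eq_zero.1 h)
    have hwb : w * (-1 - a) ≠ 0 := fun h => ha' (hw.mul_right_eq_zero.1 h)
    have hm := multiset_eq_of_fermatCMType_eq_coprimeSix hN2 hN3 hw0 hwa hwb (by ring) one_ne_zero ha ha' (by ring) hEq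
    exact eq_one_or_families_of_multiset_eq hN3 ha ha' hm
  · rintro (rfl | hE)
    · rw [one_mul, one_mul]
    · exact fermatCMType_eq_of_multiset_eq (multiset_eq_of_families hE)

/-- **THEOREM 2's STABILISER DICHOTOMY IN FULL AT EVERY `N` PRIME TO `6`**: for `a, −1−a ≠ 0` (unit or boundary entries), `W_{1,a,−1−a} =
{1}` iff `{1, a, −1−a}` is neither `{1, w, w²}` with `1 + w + w² = 0`, `w ≠ 1`, nor `{1, w, −1−w}` with `w² = 1`, `w ≠ ±1` — as conditions
on `a`: NOT (`1 + a + a² = 0 ∧ a ≠ 1`), NOT (`a² = 1 ∧ a ≠ ±1`), NOT (`(1 + a)² = 1 ∧ a ∉ {0, −2}`) ("`L_{r,s}` is simple if and only if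
`W_{r,s} = {1}`", §1). [cite: KoblitzRohrlich1978, Theorem 2 (pp. 1185–1186) and §1 (p. 1184)] -/
theorem hasTrivialStabilizer_fermat_one_iff_coprimeSix (hN2 : Nat.Coprime 2 N) (hN3 : Nat.Coprime 3 N) {a : ZMod N} (ha : a ≠ 0)
    (ha' : (-1 - a : ZMod N) ≠ 0) :
    HasTrivialStabilizer N (fermatCMType N 1 a (-1 - a)) ↔
      ¬(1 + a + a ^ 2 = 0 ∧ a ≠ 1) ∧ ¬(a ^ 2 = 1 ∧ a ≠ 1 ∧ a ≠ -1) ∧ ¬((1 + a) ^ 2 = 1 ∧ a ≠ 0 ∧ a ≠ -2) := by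
  have h3 := three_ne_zero_tw hN3 ha
  rw [hasTrivialStabilizer_iff_of_table_tw
    (E := fun w => (1 + a + a ^ 2 = 0 ∧ a ≠ 1 ∧ (w = a ∨ w = a ^ 2)) ∨ (a ^ 2 = 1 ∧ a ≠ 1 ∧ a ≠ -1 ∧ w = a) ∨
      ((1 + a) ^ 2 = 1 ∧ a ≠ 0 ∧ a ≠ -2 ∧ w = -1 - a))
    (fun w hw => fermatCMType_mul_eq_iff_coprimeSix hN2 hN3 ha ha' hw)
    (by
      rintro w (⟨hf, h1, rfl | rfl⟩ | ⟨_, h1, _, rfl⟩ | ⟨_, _, h2, rfl⟩)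
      · exact h1
      · -- `a² = 1` with `1 + a + a² = 0` would give `a = −2`, `3 = 0`
        intro e
        have e2 : a = -2 := by linear_combination hf - e
        rw [e2] at e
        exact h3 (by linear_combination e)
      · exact h1
      · intro e
        exact h2 (by linear_combination (-1 : ZMod N) * e))]
  constructor
  · intro H
    refine ⟨fun h => H ⟨a, ?_, Or.inl ⟨h.1, h.2, Or.inl rfl⟩⟩, fun h => H ⟨a, ?_, Or.inr (Or.inl ⟨h.1, h.2.1, h.2.2, rfl⟩)⟩,
      fun h => H ⟨-1 - a, ?_, Or.inr (Or.inr ⟨h.1, h.2.1, h.2.2, rfl⟩)⟩⟩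
    · exact IsUnit.of_mul_eq_one (-1 - a) (by linear_combination (-1 : ZMod N) * h.1)
    · exact IsUnit.of_mul_eq_one a (by rw [← sq]; exact h.1)
    · exact IsUnit.of_mul_eq_one (-1 - a) (by linear_combination h.1)
  · rintro ⟨H1, H2, H3⟩ ⟨w, -, (⟨h1, h2, -⟩ | ⟨h1, h2, h3, -⟩ | ⟨h1, h2, h3, -⟩)⟩
    · exact H1 ⟨h1, h2⟩
    · exact H2 ⟨h1, h2, h3⟩
    · exact H3 ⟨h1, h2, h3⟩

open CategoryTheory
open Literature.AlgebraicGeometry.Motives (AbelianVariety)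

variable {L : Type} [Field L] [NumberField L] [IsCyclotomicExtension {N} ℚ L]
  {A : AbelianVariety ℂ} {ι : 𝓞 L →+* End A} {θ : L →+* Module.End ℂ (complexBetti A.X 1)}

/-- **THEOREM 2 on CM types at every `N` prime to `6`**: `Φ_{(1,a,−1−a)}` of `ℚ(ζ_N)` (`a, −1−a ≠ 0`, unit or boundary; when it is a CM
type) is PRIMITIVE iff `{1, a, −1−a}` lies in neither printed family. [cite: KoblitzRohrlich1978, Theorem 2 (pp. 1185–1186)]
[cite: Shimura1998, §8.2 Prop. 26 and §8.4 Example (1)] -/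
theorem isPrimitive_fermat_one_iff_coprimeSix (hN2 : Nat.Coprime 2 N) (hN3 : Nat.Coprime 3 N) {a : ZMod N} (ha : a ≠ 0)
    (ha' : (-1 - a : ZMod N) ≠ 0)
    {hS : ∀ c : ZMod N, c.val.Coprime N → (c ∈ fermatCMType N 1 a (-1 - a) ↔ -c ∉ fermatCMType N 1 a (-1 - a))}
    (φ₀ : L →+* ℂ) :
    IsPrimitive (ℂ ≃+* ℂ) (cmTypeOfResidues (L := L) (fermatCMType N 1 a (-1 - a)) hS).1 φ₀ ↔
      ¬(1 + a + a ^ 2 = 0 ∧ a ≠ 1) ∧ ¬(a ^ 2 = 1 ∧ a ≠ 1 ∧ a ≠ -1) ∧ ¬((1 + a) ^ 2 = 1 ∧ a ≠ 0 ∧ a ≠ -2) := by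
  rw [CyclotomicCMTypeResidueSets.isPrimitive_iff_hasTrivialStabilizer N,
    CyclotomicCMTypeResidueSets.residueSet_cmTypeOfResidues N (isCMResidueSet_fermatCMType hS)]
  exact hasTrivialStabilizer_fermat_one_iff_coprimeSix hN2 hN3 ha ha'

/-- **THEOREM 2 ON ABELIAN VARIETIES AT EVERY `N` PRIME TO `6`** ("The only lattices `L_{r,s,t}` which are not simple are those for which
`{r, s, t}` is equivalent to a triple of the form `{N/M, ⟨wN/M⟩, ⟨w²N/M⟩}` … `1 + w + w² = 0`, or … `{N/M, ⟨wN/M⟩, ⟨−(1+w)N/M⟩}` … `w² =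
1`, `w ≠ ±1`", here at `M = N`, triples normalised through `1`): an abelian variety of type `(ℚ(ζ_N); Φ_{(1,a,−1−a)})`, `a, −1−a ≠ 0` — unit
OR boundary —, is SIMPLE iff NOT (`1 + a + a² = 0 ∧ a ≠ 1`), NOT (`a² = 1 ∧ a ≠ ±1`) and NOT (`(1 + a)² = 1 ∧ a ∉ {0, −2}`).
[cite: KoblitzRohrlich1978, Theorem 2 (pp. 1185–1186)] [cite: Shimura1998, §8.2 Prop. 26] -/
theorem isSimple_of_fermat_one_iff_coprimeSix (hN2 : Nat.Coprime 2 N) (hN3 : Nat.Coprime 3 N) {a : ZMod N} (ha : a ≠ 0)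
    (ha' : (-1 - a : ZMod N) ≠ 0)
    {hS : ∀ c : ZMod N, c.val.Coprime N → (c ∈ fermatCMType N 1 a (-1 - a) ↔ -c ∉ fermatCMType N 1 a (-1 - a))}
    (hA : IsCMTypeRealisation (cmTypeOfResidues (L := L) (fermatCMType N 1 a (-1 - a)) hS) A ι θ) :
    A.IsSimple ↔ ¬(1 + a + a ^ 2 = 0 ∧ a ≠ 1) ∧ ¬(a ^ 2 = 1 ∧ a ≠ 1 ∧ a ≠ -1) ∧ ¬((1 + a) ^ 2 = 1 ∧ a ≠ 0 ∧ a ≠ -2) := by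
  obtain ⟨φ₀⟩ : Nonempty (L →+* ℂ) := inferInstance
  rw [isSimple_iff_isPrimitive hA φ₀, isPrimitive_fermat_one_iff_coprimeSix hN2 hN3 ha ha' φ₀]

end TheoremTwo

/-! ## §3 "Suppose `rM/N, sM/N, tM/N` each have a common factor with `M` … whence `w ≡ 1 mod M`. Hence `L_{r,s,t}` is simple" -/

section NoUnitEntry

variable {N : ℕ} [NeZero N]

/-- `p ∣ N`, `p ∣ ⟨ux⟩` iff `p ∣ ⟨x⟩` for a unit `u` (private copy). [folklore] -/
private theorem dvd_val_mul_iff_of_isUnit_tw {p : ℕ} (hpN : p ∣ N) {u : ZMod N} (hu : IsUnit u) (x : ZMod N) :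
    p ∣ (u * x).val ↔ p ∣ x.val := by
  constructor
  · intro hx
    rw [ZMod.val_mul, Nat.dvd_mod_iff hpN] at hx
    have hc : Nat.Coprime p u.val := (Nat.Coprime.coprime_dvd_right hpN ((isUnit_iff_val_coprime_tw u).1 hu)).symm
    exact hc.dvd_of_dvd_mul_left hx
  · intro h
    rw [ZMod.val_mul]
    exact (Nat.dvd_mod_iff hpN).2 (dvd_mul_of_dvd_right h _)

/-- `q ∣ N`, `a + b + c = 0`, `q ∣ ⟨a⟩, ⟨b⟩` ⟹ `q ∣ ⟨c⟩` (private copy). [folklore] -/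
private theorem dvd_val_of_add_eq_zero_tw {q : ℕ} (hq : q ∣ N) {a b c : ZMod N} (h : a + b + c = 0) (ha : q ∣ a.val)
    (hb : q ∣ b.val) : q ∣ c.val := by
  have h1 : ((a + b).val + c.val) % N = 0 := by rw [← ZMod.val_add, h, ZMod.val_zero]
  have h2 : q ∣ (a + b).val + c.val := dvd_trans hq (Nat.dvd_of_mod_eq_zero h1)
  have h3 : q ∣ (a + b).val := by rw [ZMod.val_add, Nat.dvd_mod_iff hq]; exact dvd_add ha hb
  exact (Nat.dvd_add_right h3).1 h2

/-- **A stabilising unit fixes each entry when no entry is a unit** ("suppose `rM/N, sM/N, tM/N` each have a common factor with `M`. Then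
necessarily `⟨w⁻¹r⟩ = r`, `⟨w⁻¹s⟩ = s`, `⟨w⁻¹t⟩ = t`, whence `w ≡ 1 mod M`", p. 1186): at `N` prime to `6`, for an admissible PRIMITIVE
triple `τ` two of whose entries, `r` and `s`, are non-units (K–R: all three), every unit `w` with `H_τ = {x | wx ∈ H_τ}` equals `1` — by
THEOREM 1 (i) `{r, s, t} = {wr, ws, wt}`; `wr ∈ {s, t}` would put a prime of `⟨r⟩` into two entries, hence into all three (primitivity); so `(w − 1)r = (w − 1)s = 0`, and `N`
divides `⟨w − 1⟩·g.c.d.(⟨r⟩, ⟨s⟩)` with `g.c.d.(⟨r⟩, ⟨s⟩)` prime to `N`. [cite: KoblitzRohrlich1978, proof of Theorem 2 (p. 1186)] -/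
theorem eq_one_of_forall_mem_iff_of_not_isUnit (hN2 : Nat.Coprime 2 N) (hN3 : Nat.Coprime 3 N) {r s t w : ZMod N}
    (hr : r ≠ 0) (hs : s ≠ 0) (ht : t ≠ 0) (hrst : r + s + t = 0)
    (hprim : ∀ q : ℕ, q.Prime → q ∣ N → ¬(q ∣ r.val ∧ q ∣ s.val ∧ q ∣ t.val))
    (hru : ¬IsUnit r) (hsu : ¬IsUnit s) (hw : IsUnit w)
    (H : ∀ x, x ∈ fermatCMType N r s t ↔ w * x ∈ fermatCMType N r s t) : w = 1 := by
  classical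
  have hm := (forall_mem_fermatCMType_iff_iff_multiset_eq_coprimeSix hN2 hN3 hr hs ht hrst hr hs ht hrst hw).1 H
  -- a prime of `N` at each non-unit entry
  have hex : ∀ {x : ZMod N}, ¬IsUnit x → ∃ p : ℕ, p.Prime ∧ p ∣ N ∧ p ∣ x.val := fun {x} hx => by
    rw [isUnit_iff_val_coprime_tw] at hx
    obtain ⟨p, hp, hpx, hpN⟩ := Nat.Prime.not_coprime_iff_dvd.1 hx
    exact ⟨p, hp, hpN, hpx⟩
  obtain ⟨p, hp, hpN, hpr⟩ := hex hru
  obtain ⟨q, hq, hqN, hqs⟩ := hex hsu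
  -- `wr = r` and `ws = s`
  have hmem : ∀ y ∈ ({w * r, w * s, w * t} : Multiset (ZMod N)), y ∈ ({r, s, t} : Multiset (ZMod N)) := fun y hy => by
    rw [hm]; exact hy
  have hwr : w * r = r := by
    have h1 := hmem (w * r) (by simp)
    simp only [Multiset.insert_eq_cons, Multiset.mem_cons, Multiset.mem_singleton] at h1
    rcases h1 with h1 | h1 | h1
    · exact h1
    · exfalso
      have hps : p ∣ s.val := by rw [← h1]; exact (dvd_val_mul_iff_of_isUnit_tw hpN hw r).2 hpr
      exact hprim p hp hpN ⟨hpr, hps, dvd_val_of_add_eq_zero_tw hpN hrst hpr hps⟩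
    · exfalso
      have hpt : p ∣ t.val := by rw [← h1]; exact (dvd_val_mul_iff_of_isUnit_tw hpN hw r).2 hpr
      have hps : p ∣ s.val :=
        dvd_val_of_add_eq_zero_tw hpN (by rw [show r + t + s = r + s + t by ring]; exact hrst) hpr hpt
      exact hprim p hp hpN ⟨hpr, hps, hpt⟩
  have hws : w * s = s := by
    have h1 := hmem (w * s) (by simp)
    simp only [Multiset.insert_eq_cons, Multiset.mem_cons, Multiset.mem_singleton] at h1
    rcases h1 with h1 | h1 | h1
    · exfalso
      have hqr : q ∣ r.val := by rw [← h1]; exact (dvd_val_mul_iff_of_isUnit_tw hqN hw s).2 hqs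
      exact hprim q hq hqN ⟨hqr, hqs, dvd_val_of_add_eq_zero_tw hqN hrst hqr hqs⟩
    · exact h1
    · exfalso
      have hqt : q ∣ t.val := by rw [← h1]; exact (dvd_val_mul_iff_of_isUnit_tw hqN hw s).2 hqs
      have hqr : q ∣ r.val :=
        dvd_val_of_add_eq_zero_tw hqN (by rw [show s + t + r = r + s + t by ring]; exact hrst) hqs hqt
      exact hprim q hq hqN ⟨hqr, hqs, hqt⟩
  -- `N ∣ ⟨w − 1⟩·⟨r⟩` and `N ∣ ⟨w − 1⟩·⟨s⟩`, with `g.c.d.(⟨r⟩, ⟨s⟩)` prime to `N`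
  have hdvd : ∀ {x : ZMod N}, w * x = x → N ∣ (w - 1).val * x.val := fun {x} hx => by
    have h0 : (w - 1) * x = 0 := by rw [sub_mul, one_mul, hx, sub_self]
    have h1 : ((w - 1) * x).val = 0 := by rw [h0, ZMod.val_zero]
    rw [ZMod.val_mul] at h1
    exact Nat.dvd_of_mod_eq_zero h1
  have hg : Nat.Coprime N (Nat.gcd r.val s.val) := by
    by_contra hc
    obtain ⟨ℓ, hℓ, hℓN, hℓg⟩ := Nat.Prime.not_coprime_iff_dvd.1 hc
    have hℓr : ℓ ∣ r.val := hℓg.trans (Nat.gcd_dvd_left _ _)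
    have hℓs : ℓ ∣ s.val := hℓg.trans (Nat.gcd_dvd_right _ _)
    exact hprim ℓ hℓ hℓN ⟨hℓr, hℓs, dvd_val_of_add_eq_zero_tw hℓN hrst hℓr hℓs⟩
  have hN : N ∣ (w - 1).val := by
    have h1 : N ∣ Nat.gcd ((w - 1).val * r.val) ((w - 1).val * s.val) := Nat.dvd_gcd (hdvd hwr) (hdvd hws)
    rw [Nat.gcd_mul_left] at h1
    exact hg.dvd_of_dvd_mul_right h1
  have hlt := ZMod.val_lt (w - 1)
  have h0 : (w - 1).val = 0 := Nat.eq_zero_of_dvd_of_lt hN hlt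
  exact sub_eq_zero.1 ((ZMod.val_eq_zero _).1 h0)

/-- **`W_τ = {1}` when two entries (K–R: all three) of the primitive triple `τ` are non-units**, at every `N` prime to `6`.
[cite: KoblitzRohrlich1978, proof of Theorem 2 (p. 1186) and §1 (p. 1184)] -/
theorem hasTrivialStabilizer_of_not_isUnit (hN2 : Nat.Coprime 2 N) (hN3 : Nat.Coprime 3 N) {r s t : ZMod N}
    (hr : r ≠ 0) (hs : s ≠ 0) (ht : t ≠ 0) (hrst : r + s + t = 0)
    (hprim : ∀ q : ℕ, q.Prime → q ∣ N → ¬(q ∣ r.val ∧ q ∣ s.val ∧ q ∣ t.val))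
    (hru : ¬IsUnit r) (hsu : ¬IsUnit s) : HasTrivialStabilizer N (fermatCMType N r s t) := by
  intro w hw hstab
  have hwu : IsUnit w := (mem_unitResidues_iff_isUnit w).1 hw
  refine eq_one_of_forall_mem_iff_of_not_isUnit hN2 hN3 hr hs ht hrst hprim hru hsu hwu fun x => ?_
  by_cases hx : IsUnit x
  · rw [mul_comm]
    exact (hstab x ((mem_unitResidues_iff_isUnit x).2 hx)).symm
  · constructor
    · exact fun h => absurd (isUnit_of_mem_fermatCMType h) hx
    · intro h
      exact absurd (isUnit_of_mul_isUnit_right (isUnit_of_mem_fermatCMType h)) hx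

open CategoryTheory
open Literature.AlgebraicGeometry.Motives (AbelianVariety)

variable {L : Type} [Field L] [NumberField L] [IsCyclotomicExtension {N} ℚ L]
  {A : AbelianVariety ℂ} {ι : 𝓞 L →+* End A} {θ : L →+* Module.End ℂ (complexBetti A.X 1)}

/-- **"Hence `L_{r,s,t}` is simple"**: at every `N` prime to `6`, an abelian variety of type `(ℚ(ζ_N); Φ_{H_τ})` for an admissible primitive
triple `τ` with `r`, `s` non-units (K–R: all three entries; when `H_τ` is a CM type) is SIMPLE. [cite: KoblitzRohrlich1978, Theorem 2 and its proof (p. 1186)]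
[cite: Shimura1998, §8.2 Prop. 26] -/
theorem isSimple_of_not_isUnit (hN2 : Nat.Coprime 2 N) (hN3 : Nat.Coprime 3 N) {r s t : ZMod N}
    (hr : r ≠ 0) (hs : s ≠ 0) (ht : t ≠ 0) (hrst : r + s + t = 0)
    (hprim : ∀ q : ℕ, q.Prime → q ∣ N → ¬(q ∣ r.val ∧ q ∣ s.val ∧ q ∣ t.val))
    (hru : ¬IsUnit r) (hsu : ¬IsUnit s)
    {hS : ∀ c : ZMod N, c.val.Coprime N → (c ∈ fermatCMType N r s t ↔ -c ∉ fermatCMType N r s t)}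
    (hA : IsCMTypeRealisation (cmTypeOfResidues (L := L) (fermatCMType N r s t) hS) A ι θ) : A.IsSimple := by
  obtain ⟨φ₀⟩ : Nonempty (L →+* ℂ) := inferInstance
  rw [isSimple_iff_isPrimitive hA φ₀, CyclotomicCMTypeResidueSets.isPrimitive_iff_hasTrivialStabilizer N,
    CyclotomicCMTypeResidueSets.residueSet_cmTypeOfResidues N (isCMResidueSet_fermatCMType hS)]
  exact hasTrivialStabilizer_of_not_isUnit hN2 hN3 hr hs ht hrst hprim hru hsu

end NoUnitEntry

end CyclotomicFermatCMType

end Literature.AlgebraicGeometry.ComplexMultiplication
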